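import Mathlib
import Summits.MatrixMultiplication.MatrixMultiplication.Theses.AutomaticSTPPDesigns
import Literature.Computability.AutomaticStructures.AutomaticBlock
import Literature.Combinatorics.Additive.TripleProductProperty
import Summits.MatrixMultiplication.MatrixMultiplication.Theorems.AutomaticSTPPDesignsRegularTowerGapStubAbelianSubPacking
import Summits.MatrixMultiplication.MatrixMultiplication.Theorems.AutomaticSTPPDesignsRegularTowerGapStubEntrySumSubmul
import Summits.MatrixMultiplication.MatrixMultiplication.Theorems.AutomaticSTPPDesignsRegularTowerGapStubFekete
import Summits.MatrixMultiplication.MatrixMultiplication.Theorems.AutomaticSTPPDesignsRegularTowerGapStubExponentBump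
import Summits.MatrixMultiplication.MatrixMultiplication.Theorems.AutomaticSTPPDesignsRegularTowerGapStubOneGoodScale

/-!
# MatrixMultiplication / AutomaticSTPPDesigns — `RegularTowerGap` (stmt-MatrixMultiplication-7358)

Route `AutomaticSTPPDesigns`, crux `RegularTowerGap`, line `Sketch` (removal × Fekete): the
composition. **Claim.** For every base `p ≥ 2` and every triple of regular languages over
`ι × Fin p` whose automatic family `(A_w, B_w, C_w)_{w ∈ ι^k}` is STPP in `ℤ/(p^k)` at every scale
`k`, there is `ε > 0` with `∑_w (|A_w||B_w||C_w|)^{(2+ε)/3} ≤ p^k` for all large `k` — no single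
automaton witnesses the route's packing thesis at every `ε` (the regular-tower analogue of the
Coppersmith–Winograd infimum-not-minimum phenomenon).

**Proof** (`regularTowerGap_proof`):

1. `stub_abelianSubPacking` — removal: every STPP family in a finite abelian group `H` has
   `∑ (|A||B||C|)^{2/3} ≤ η |H|` once `|H| ≥ N₀(η)` (Green's arithmetic removal lemma + the
   sum-of-minima count + AM–GM).
2. Transfer matrices (`Literature…DigitPathCount`, transported in `…StubOneGoodScale`): choose
   DFAs; `T_k(w)[q,q']` = product of the
   three digit-path counts `N_X s s' k w` (introduced through their characterising equations);
   `x_w = |A_w||B_w||C_w| = ∑_{f accepting} T_k(w)[q₀,f]`; `T` is multiplicative along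
   `Fin.append`.
3. Trim to the set `R` of state triples jointly reachable from the start triple and jointly
   co-reachable to an accepting triple; `Z_τ(k) = ∑_w ∑_{q,q'∈R} T_k(w)[q,q']^τ` dominates
   `F_τ(k) = ∑_w x_w^τ` and is submultiplicative for `0 < τ ≤ 1` (`stub_entrySum_submul`).
4. `stub_oneGoodScale` — STPP re-entry: each trimmed entry is the size product of a SUB-block
   triple of genuine blocks at scale `m+k+n` along `u_q · w · v_{q'}`; these sub-families are STPP,
   so by (1) `Z_{2/3}(k₀) < p^{k₀}` at some scale `k₀ ≥ 1`.
5. `stub_exponent_bump` moves the strict inequality to some `τ₀ ∈ (2/3, 1]` at that one scale;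
   `stub_fekete` turns `Z_{τ₀}(k₀) < p^{k₀}` into `Z_{τ₀}(k) ≤ p^k` for all large `k`; with
   `ε = 3τ₀ - 2` this is the crux.
-/

-- single-conjunct summit: the mandated namespace repeats `MatrixMultiplication`.
set_option linter.dupNamespace false

noncomputable section

open Finset

open scoped BigOperators Classical

namespace Summit.MatrixMultiplication.MatrixMultiplication.Theorems.RegularTowerGap

open Literature.Combinatorics.Additive (AddSimultaneousTPP)
open Literature.Computability.AutomaticStructures

/-! ## Glue: triple products of sums -/

/-- `(∑ f)(∑ g)(∑ h) = ∑ over the product set of `f · g · h`. -/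
theorem sum_mul_sum_mul_sum {α β γ R : Type*} [CommSemiring R] (s : Finset α) (t : Finset β)
    (r : Finset γ) (f : α → R) (g : β → R) (h : γ → R) :
    (∑ a ∈ s, f a) * (∑ b ∈ t, g b) * (∑ c ∈ r, h c) =
      ∑ x ∈ s ×ˢ (t ×ˢ r), f x.1 * g x.2.1 * h x.2.2 := by
  rw [Finset.sum_product, Finset.sum_mul_sum, Finset.sum_mul]
  refine Finset.sum_congr rfl fun a _ => ?_
  rw [Finset.sum_product, Finset.sum_mul]
  refine Finset.sum_congr rfl fun b _ => ?_
  rw [Finset.mul_sum]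

/-! ## The composition -/

/-- **`RegularTowerGap`** (crux stmt-MatrixMultiplication-7358, exact route signature
`Summit.MatrixMultiplication.MatrixMultiplication.Theses.AutomaticSTPPDesigns.RegularTowerGap`):
for every base `p ≥ 2` and every triple of regular languages over `ι × Fin p` whose automatic
family is STPP in `ℤ/(p^k)` at every scale, there is `ε > 0` such that eventually
`∑_w (|A_w||B_w||C_w|)^{(2+ε)/3} ≤ p^k`. Removal (`stub_abelianSubPacking`, inside
`stub_oneGoodScale`) gives one sub-critical scale of the trimmed transfer-matrix entry sum, and
submultiplicativity (`stub_entrySum_submul`, `stub_fekete`) amplifies it to an exponential gap. -/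
theorem regularTowerGap_proof :
    Summit.MatrixMultiplication.MatrixMultiplication.Theses.AutomaticSTPPDesigns.RegularTowerGap :=
    by
  intro p ι _ LA LB LC hp hA hB hC
  show (∀ k : ℕ, AddSimultaneousTPP (automaticBlock p k LA) (automaticBlock p k LB)
      (automaticBlock p k LC)) →
    ∃ ε : ℝ, 0 < ε ∧ ∃ k₀ : ℕ, ∀ k ≥ k₀, ∑ w : Fin k → ι,
      (((automaticBlock p k LA w).card * (automaticBlock p k LB w).card *
        (automaticBlock p k LC w).card : ℕ) : ℝ) ^ ((2 + ε) / 3) ≤ (p : ℝ) ^ k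
  intro hS
  obtain ⟨σA, _, MA, rfl⟩ := hA
  obtain ⟨σB, _, MB, rfl⟩ := hB
  obtain ⟨σC, _, MC, rfl⟩ := hC
  -- the digit-track path counts of the three automata, through their characterising equations
  obtain ⟨NA, hNA⟩ : ∃ NA : σA → σA → (k : ℕ) → (Fin k → ι) → ℕ, ∀ s s' k w, NA s s' k w =
      ((Finset.univ : Finset (Fin k → Fin p)).filter
        (fun a => MA.evalFrom s (List.ofFn fun j : Fin k => (w j, a j)) = s')).card :=
    ⟨_, fun _ _ _ _ => rfl⟩
  obtain ⟨NB, hNB⟩ : ∃ NB : σB → σB → (k : ℕ) → (Fin k → ι) → ℕ, ∀ s s' k w, NB s s' k w =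
      ((Finset.univ : Finset (Fin k → Fin p)).filter
        (fun a => MB.evalFrom s (List.ofFn fun j : Fin k => (w j, a j)) = s')).card :=
    ⟨_, fun _ _ _ _ => rfl⟩
  obtain ⟨NC, hNC⟩ : ∃ NC : σC → σC → (k : ℕ) → (Fin k → ι) → ℕ, ∀ s s' k w, NC s s' k w =
      ((Finset.univ : Finset (Fin k → Fin p)).filter
        (fun a => MC.evalFrom s (List.ofFn fun j : Fin k => (w j, a j)) = s')).card :=
    ⟨_, fun _ _ _ _ => rfl⟩
  have hp0 : (0 : ℝ) < p := by exact_mod_cast (by omega : 0 < p)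
  have hp1 : (1 : ℝ) ≤ p := by exact_mod_cast (by omega : 1 ≤ p)
  -- the joint transfer count and its structure
  set q₀ : σA × σB × σC := (MA.start, MB.start, MC.start) with hq₀
  set T : (k : ℕ) → (Fin k → ι) → σA × σB × σC → σA × σB × σC → ℕ := fun k w q q' =>
    NA q.1 q'.1 k w * NB q.2.1 q'.2.1 k w * NC q.2.2 q'.2.2 k w with hT
  have T_append : ∀ (k l : ℕ) (u : Fin k → ι) (v : Fin l → ι) (q q'' : σA × σB × σC),
      T (k + l) (Fin.append u v) q q'' = ∑ q', T k u q q' * T l v q' q'' := by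
    intro k l u v q q''
    simp only [hT, count_append MA NA hNA, count_append MB NB hNB,
      count_append MC NC hNC]
    rw [sum_mul_sum_mul_sum, Finset.univ_product_univ, Finset.univ_product_univ]
    refine Finset.sum_congr rfl fun x _ => ?_
    ring
  have T_zero : ∀ (w : Fin 0 → ι) (q q' : σA × σB × σC), T 0 w q q' = if q = q' then 1 else 0 := by
    intro w q q'
    simp only [hT, count_zero MA NA hNA, count_zero MB NB hNB, count_zero MC NC hNC]
    obtain ⟨a, b, c⟩ := q
    obtain ⟨a', b', c'⟩ := q'
    by_cases ha : a = a' <;> by_cases hb : b = b' <;> by_cases hc : c = c' <;>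
      simp [ha, hb, hc]
  -- accepting triples and the trimmed state set
  set Facc : Finset (σA × σB × σC) :=
    (Finset.univ.filter fun a : σA => a ∈ MA.accept) ×ˢ
      ((Finset.univ.filter fun b : σB => b ∈ MB.accept) ×ˢ
        (Finset.univ.filter fun c : σC => c ∈ MC.accept)) with hFacc
  have mem_Facc : ∀ f : σA × σB × σC,
      f ∈ Facc ↔ f.1 ∈ MA.accept ∧ f.2.1 ∈ MB.accept ∧ f.2.2 ∈ MC.accept := by
    intro f
    simp only [hFacc, Finset.mem_product, Finset.mem_filter, Finset.mem_univ, true_and]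
  set R : Finset (σA × σB × σC) := Finset.univ.filter fun q =>
    (∃ (m : ℕ) (u : Fin m → ι), T m u q₀ q ≠ 0) ∧
      ∃ (n : ℕ) (v : Fin n → ι) (f : σA × σB × σC), f ∈ Facc ∧ T n v q f ≠ 0 with hR
  have mem_R : ∀ q, q ∈ R ↔ (∃ (m : ℕ) (u : Fin m → ι), T m u q₀ q ≠ 0) ∧
      ∃ (n : ℕ) (v : Fin n → ι) (f : σA × σB × σC), f ∈ Facc ∧ T n v q f ≠ 0 := by
    intro q
    simp only [hR, Finset.mem_filter, Finset.mem_univ, true_and]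
  -- a nonzero product of entries has its intermediate state in `R`
  have T_append_ne : ∀ (k l : ℕ) (u : Fin k → ι) (v : Fin l → ι) (q q' q'' : σA × σB × σC),
      T k u q q' ≠ 0 → T l v q' q'' ≠ 0 → T (k + l) (Fin.append u v) q q'' ≠ 0 := by
    intro k l u v q q' q'' h1 h2
    rw [T_append]
    intro h0
    have hle : T k u q q' * T l v q' q'' ≤ ∑ x, T k u q x * T l v x q'' :=
      Finset.single_le_sum (f := fun x => T k u q x * T l v x q'') (fun _ _ => Nat.zero_le _)
        (Finset.mem_univ q')
    rw [h0, Nat.le_zero, mul_eq_zero] at hle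
    exact hle.elim h1 h2
  have R_closed : ∀ (k l : ℕ) (u : Fin k → ι) (v : Fin l → ι) (q q' q'' : σA × σB × σC),
      q ∈ R → q'' ∈ R → T k u q q' ≠ 0 → T l v q' q'' ≠ 0 → q' ∈ R := by
    intro k l u v q q' q'' hq hq'' h1 h2
    rw [mem_R] at hq hq'' ⊢
    obtain ⟨⟨m, u₀, hu₀⟩, -⟩ := hq
    obtain ⟨-, ⟨n, v₀, f, hf, hv₀⟩⟩ := hq''
    exact ⟨⟨m + k, Fin.append u₀ u, T_append_ne _ _ _ _ _ _ _ hu₀ h1⟩,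
      ⟨l + n, Fin.append v v₀, f, hf, T_append_ne _ _ _ _ _ _ _ h2 hv₀⟩⟩
  -- the size products are start rows of `T` summed over accepting triples
  have x_eq : ∀ (k : ℕ) (w : Fin k → ι),
      (automaticBlock p k MA.accepts w).card * (automaticBlock p k MB.accepts w).card *
          (automaticBlock p k MC.accepts w).card = ∑ f ∈ Facc, T k w q₀ f := by
    intro k w
    rw [card_automaticBlock_eq_sum_count MA NA hNA, card_automaticBlock_eq_sum_count MB NB hNB,
      card_automaticBlock_eq_sum_count MC NC hNC, sum_mul_sum_mul_sum]
  -- the trimmed entry sums `Z τ k`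
  set Z : ℝ → ℕ → ℝ := fun τ k =>
    ∑ w : Fin k → ι, ∑ q ∈ R, ∑ q' ∈ R, ((T k w q q' : ℕ) : ℝ) ^ τ with hZ
  have Z_nonneg : ∀ τ k, 0 ≤ Z τ k := fun τ k =>
    Finset.sum_nonneg fun _ _ => Finset.sum_nonneg fun _ _ => Finset.sum_nonneg fun _ _ =>
      Real.rpow_nonneg (Nat.cast_nonneg _) _
  -- domination `F_τ(k) ≤ Z_τ(k)` for `0 < τ ≤ 1`
  have F_le_Z : ∀ (τ : ℝ), 0 < τ → τ ≤ 1 → ∀ k : ℕ,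
      ∑ w : Fin k → ι, (((automaticBlock p k MA.accepts w).card *
        (automaticBlock p k MB.accepts w).card *
          (automaticBlock p k MC.accepts w).card : ℕ) : ℝ) ^ τ ≤ Z τ k := by
    intro τ hτ hτ1 k
    simp only [hZ]
    refine Finset.sum_le_sum fun w _ => ?_
    rw [x_eq]
    -- either the start row vanishes on accepting triples, or `q₀ ∈ R`
    by_cases h0 : ∀ f ∈ Facc, T k w q₀ f = 0
    · rw [Finset.sum_eq_zero h0, Nat.cast_zero, Real.zero_rpow hτ.ne']
      exact Finset.sum_nonneg fun _ _ => Finset.sum_nonneg fun _ _ =>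
        Real.rpow_nonneg (Nat.cast_nonneg _) _
    push Not at h0
    obtain ⟨f₀, hf₀, hTf₀⟩ := h0
    have hq₀R : q₀ ∈ R := by
      rw [mem_R]
      refine ⟨⟨0, Fin.elim0, ?_⟩, ⟨k, w, f₀, hf₀, hTf₀⟩⟩
      rw [T_zero, if_pos rfl]; exact one_ne_zero
    have hfR : ∀ f ∈ Facc, T k w q₀ f ≠ 0 → f ∈ R := by
      intro f hf hTf
      rw [mem_R]
      refine ⟨⟨k, w, hTf⟩, ⟨0, Fin.elim0, f, hf, ?_⟩⟩
      rw [T_zero, if_pos rfl]; exact one_ne_zero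
    calc (((∑ f ∈ Facc, T k w q₀ f : ℕ) : ℝ)) ^ τ
        = (∑ f ∈ Facc, ((T k w q₀ f : ℕ) : ℝ)) ^ τ := by rw [Nat.cast_sum]
      _ ≤ ∑ f ∈ Facc, ((T k w q₀ f : ℕ) : ℝ) ^ τ :=
          entrySum_rpow_sum_le_sum_rpow _ _ (fun _ _ => Nat.cast_nonneg _) hτ hτ1
      _ = ∑ f ∈ Facc.filter (fun f => T k w q₀ f ≠ 0), ((T k w q₀ f : ℕ) : ℝ) ^ τ := by
          rw [Finset.sum_filter]
          refine Finset.sum_congr rfl fun f _ => ?_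
          by_cases h : T k w q₀ f ≠ 0
          · rw [if_pos h]
          · rw [if_neg h]
            push Not at h
            rw [h, Nat.cast_zero, Real.zero_rpow hτ.ne']
      _ ≤ ∑ q' ∈ R, ((T k w q₀ q' : ℕ) : ℝ) ^ τ := by
          refine Finset.sum_le_sum_of_subset_of_nonneg (fun f hf => ?_)
            (fun _ _ _ => Real.rpow_nonneg (Nat.cast_nonneg _) _)
          rw [Finset.mem_filter] at hf
          exact hfR f hf.1 hf.2
      _ ≤ ∑ q ∈ R, ∑ q' ∈ R, ((T k w q q' : ℕ) : ℝ) ^ τ :=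
          Finset.single_le_sum (f := fun q => ∑ q' ∈ R, ((T k w q q' : ℕ) : ℝ) ^ τ)
            (fun _ _ => Finset.sum_nonneg fun _ _ => Real.rpow_nonneg (Nat.cast_nonneg _) _) hq₀R
  -- one good scale at `τ = 2/3` (removal, via the stub)
  have hRwit : ∀ q ∈ R,
      (∃ (m : ℕ) (u : Fin m → ι), NA MA.start q.1 m u * NB MB.start q.2.1 m u *
          NC MC.start q.2.2 m u ≠ 0) ∧
      (∃ (n : ℕ) (v : Fin n → ι) (f : σA × σB × σC),
          (f.1 ∈ MA.accept ∧ f.2.1 ∈ MB.accept ∧ f.2.2 ∈ MC.accept) ∧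
          NA q.1 f.1 n v * NB q.2.1 f.2.1 n v *
            NC q.2.2 f.2.2 n v ≠ 0) := by
    intro q hq
    rw [mem_R] at hq
    obtain ⟨⟨m, u, hu⟩, ⟨n, v, f, hf, hv⟩⟩ := hq
    exact ⟨⟨m, u, hu⟩, ⟨n, v, f, (mem_Facc f).1 hf, hv⟩⟩
  obtain ⟨k₀, hk₀, hgood⟩ := stub_oneGoodScale p ι σA σB σC MA MB MC NA NB NC hNA hNB hNC hp hS
    R hRwit
  have hgood' : Z ((2 : ℝ) / 3) k₀ < (p : ℝ) ^ k₀ := hgood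
  -- bump the exponent
  have hbump : ∃ τ : ℝ, 2 / 3 < τ ∧ τ ≤ 1 ∧ Z τ k₀ < (p : ℝ) ^ k₀ := by
    have hflat : ∀ τ : ℝ, Z τ k₀ =
        ∑ x ∈ (Finset.univ : Finset (Fin k₀ → ι)) ×ˢ (R ×ˢ R),
          ((T k₀ x.1 x.2.1 x.2.2 : ℕ) : ℝ) ^ τ := by
      intro τ
      simp only [hZ]
      rw [Finset.sum_product]
      refine Finset.sum_congr rfl fun w _ => ?_
      rw [Finset.sum_product]
    have hB : (1 : ℝ) ≤ ((p : ℝ) ^ k₀) ^ 3 := one_le_pow₀ (one_le_pow₀ hp1)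
    obtain ⟨τ, hτ, hτ1, hlt⟩ := stub_exponent_bump _
      ((Finset.univ : Finset (Fin k₀ → ι)) ×ˢ (R ×ˢ R))
      (fun x => ((T k₀ x.1 x.2.1 x.2.2 : ℕ) : ℝ)) (((p : ℝ) ^ k₀) ^ 3) ((p : ℝ) ^ k₀) hB
      (fun _ _ => Nat.cast_nonneg _)
      (fun x _ => by
        have h1 := count_le MA NA hNA x.2.1.1 x.2.2.1 k₀ x.1
        have h2 := count_le MB NB hNB x.2.1.2.1 x.2.2.2.1 k₀ x.1
        have h3 := count_le MC NC hNC x.2.1.2.2 x.2.2.2.2 k₀ x.1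
        have h : T k₀ x.1 x.2.1 x.2.2 ≤ (p ^ k₀) ^ 3 := by
          calc T k₀ x.1 x.2.1 x.2.2 ≤ p ^ k₀ * p ^ k₀ * p ^ k₀ :=
                Nat.mul_le_mul (Nat.mul_le_mul h1 h2) h3
            _ = (p ^ k₀) ^ 3 := by ring
        exact_mod_cast h)
      (by rw [← hflat]; exact hgood')
    exact ⟨τ, hτ, hτ1, by rw [hflat]; exact hlt⟩
  obtain ⟨τ, hτ, hτ1, hZlt⟩ := hbump
  have hτ0 : 0 < τ := by linarith
  -- Fekete amplification
  have hsub : ∀ k l, Z τ (k + l) ≤ Z τ k * Z τ l :=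
    stub_entrySum_submul ι (σA × σB × σC) T R τ hτ0 hτ1 T_append R_closed
  obtain ⟨K, hK⟩ := stub_fekete (Z τ) p hp0 (Z_nonneg τ) hsub k₀ hk₀ hZlt
  -- conclusion with `ε = 3τ - 2`
  refine ⟨3 * τ - 2, by linarith, K, fun k hk => ?_⟩
  have hexp : (2 + (3 * τ - 2)) / 3 = τ := by ring
  rw [hexp]
  exact (F_le_Z τ hτ0 hτ1 k).trans (hK k hk)

end Summit.MatrixMultiplication.MatrixMultiplication.Theorems.RegularTowerGap
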